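import Literature.AlgebraicGeometry.Motives.AbelianVarietyFrobeniusTwistVariety
import Literature.AlgebraicGeometry.Motives.CyclesPushforwardNormProofs
import Literature.AlgebraicGeometry.Motives.CartierDivisor
import HarnessLib

/-!
# Frobenius pulls a divisor back to its `q`-th multiple: `F^* D = q • D`, `F_{A/k}^*(D^{(q)}) = q • D`
# (Hartshorne IV §2 Rem. 2.4.1; Shimura 1998, proof of Thm. 18.6, p. 130 L3 «π⁻¹(X̃^f) = pX̃»)

Layer `Literature/AlgebraicGeometry/Motives`. KERNEL ONLY: theorems; no definition, no instance, no named fact,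
no `sorry`.

For an integral scheme `X` on which `s ↦ sⁿ` is additive on all rings of sections (e.g. `n = q = pᵐ` in
characteristic `p`), the tree's power endomorphism `powEndo X n` (`Motives/FrobeniusMorphism`: the identity on
points, `s ↦ sⁿ` on `𝒪_X`; the absolute `q`-Frobenius `absFrobeniusOver p m X` of `Motives/AbelianVarietyFrobeniusTwistVariety`
is the case `n = pᵐ`) acts on the function field by the `n`-th power map
(`functionFieldMap_powEndo`: `F^♯ f = fⁿ`), so the pull-back of a Cartier divisor `D = (Uᵢ, fᵢ)` along it is
`(Uᵢ, fᵢⁿ) = n • D` on the nose up to presentation (`CartierDivisor.pullback_powEndo_sameDivisor`).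
For an abelian variety `A` over a field `k` of characteristic `p` with Frobenius twist `A^{(q)}`
(`AbelianVariety.frobeniusTwist`, projection `pr : A^{(q)} → A`) and relative Frobenius
`F_{A/k} : A → A^{(q)}` (`AbelianVariety.relFrobenius`, with `F_{A/k} ≫ pr = F^{abs}`), the TWISTED divisor
`D^{(q)} := pr^* D` satisfies

  **`F_{A/k}^* (D^{(q)}) = q • D`** (same divisor)   (`CartierDivisor.pullback_relFrobenius_twist_sameDivisor`),

which is Shimura's «`π⁻¹(X̃^f) = p X̃`» [Shimura1998, proof of Thm. 18.6, chunk p0168 L3] (there `π` = the `p`-th power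
homomorphism `Ã → Ã^f`, `f = Frob`), i.e. Hartshorne IV §2 Rem. 2.4.1 / Ex. 2.4: the Frobenius pulls back
`𝒪(D^{(q)})` to `𝒪(D)^{⊗q}`.

Use (cell `hodgecm-mathlib`, row II-1 `shimura1998_thm18_6` v2, stub S5 `polarisationTransport`, W3b of
B-p20's PREP-II1-S5): with `weilPairingLevel_congr_sameDivisor` + `weilPairingLevel_smul`
(`Motives/AbelianVarietyWeilPairingDivisorClass`) it gives `ē^{F^* X̃^{(q)}} = (ē^{X̃})^q`.

DESIGN NOTE: the morphisms are passed as variables `F`, `π` with defining equations (`hF`, `hπ`) and the dominance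
instances as hypotheses, so that `CartierDivisor.pullback` elaborates on the abelian-variety-typed schemes (cf.
`Motives/AbelianVarietyWeilPairingConjugate`); `isDominant_powEndo` discharges the one for `F`.

## References
* [Hartshorne1977] R. Hartshorne, *Algebraic Geometry*, IV §2, Rem. 2.4.1 and Ex. 2.4 (Frobenius, `F'`, `X_p`).
* [Shimura1998] G. Shimura, *Abelian Varieties with Complex Multiplication and Modular Functions* (1998), proof of
  Thm. 18.6, p. 130 («`κ⁻¹(X^σ)~ = π⁻¹(X̃^f) = pX̃`»).
* [Milne2025] J. S. Milne, *Étale cohomology*, VI §13 Rem. 13.5 (`F_{X/k}`, `X^{(q)}`).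
-/

universe u

open CategoryTheory CategoryTheory.Limits AlgebraicGeometry

noncomputable section

namespace Literature.AlgebraicGeometry.Motives

open RatFn

/-! ### §1 The power endomorphism on the function field -/

section PowEndo

variable (X : Scheme.{u}) [IsIntegral X] (n : ℕ) (hn : n ≠ 0)
  (hadd : ∀ (U : X.Opens) (a b : Γ(X, U)), (a + b) ^ n = a ^ n + b ^ n)

omit [IsIntegral X] in
/-- The power endomorphism is dominant (it is the identity on points). [cite: Hartshorne1977, IV §2 Rem. 2.4.1] -/
theorem isDominant_powEndo : IsDominant (powEndo X n hn hadd) :=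
  ⟨(show Function.Surjective (powEndo X n hn hadd).base from fun x => ⟨x, rfl⟩).denseRange⟩

/-- **`F^♯ f = fⁿ` on the function field** for the power endomorphism `F = powEndo X n` (on sections it is
`s ↦ sⁿ` and it fixes the generic point). [cite: Hartshorne1977, IV §2 Rem. 2.4.1] -/
theorem functionFieldMap_powEndo (F : X ⟶ X) (hF : F = powEndo X n hn hadd) [IsDominant F] (f : X.functionField) :
    functionFieldMap F f = f ^ n := by
  subst hF
  obtain ⟨U, hξ, s, rfl⟩ := X.presheaf.exists_germ_eq f
  haveI : Nonempty U := ⟨⟨genericPoint X, hξ⟩⟩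
  haveI : Nonempty ((powEndo X n hn hadd) ⁻¹ᵁ U) := ⟨⟨genericPoint X, hξ⟩⟩
  have h := functionFieldMap_germToFunctionField (powEndo X n hn hadd) U s (genericPoint X) hξ
  change functionFieldMap (powEndo X n hn hadd) (X.germToFunctionField U s) = X.germToFunctionField U s ^ n
  rw [h, powEndo_app_apply]
  exact map_pow (X.germToFunctionField U).hom s n

/-- **`F^* D = n • D`** (same divisor) for the power endomorphism `F = powEndo X n`: the pulled-back local equations
are `F^♯ fᵢ = fᵢⁿ` on the same opens. [cite: Hartshorne1977, IV §2 Rem. 2.4.1 and Ex. 2.4] -/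
theorem CartierDivisor.pullback_powEndo_sameDivisor (F : X ⟶ X) (hF : F = powEndo X n hn hadd) [IsDominant F]
    (D : CartierDivisor X) : (D.pullback F).SameDivisor (n • D) := fun i j x hi hj => by
  change IsUnitAt x (functionFieldMap F (D.f i) / D.f j ^ n)
  rw [functionFieldMap_powEndo X n hn hadd F hF, ← div_pow]
  have hi' : x ∈ D.U i := by
    subst hF
    exact hi
  exact (D.isUnitAt_div i j x hi' hj).pow n

end PowEndo

/-! ### §2 The relative Frobenius of an abelian variety and the twisted divisor -/

namespace AbelianVariety

variable {k : Type u} [Field k] (p : ℕ) [ExpChar k p] (n : ℕ) (A : AbelianVariety k)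

/-- The absolute `q`-Frobenius of `A` (`q = pⁿ`) is dominant. [cite: Hartshorne1977, IV §2 Rem. 2.4.1] -/
theorem isDominant_absFrobeniusOver : IsDominant (absFrobeniusOver p n A.X) :=
  isDominant_powEndo A.X.left (p ^ n) _ _

/-- **`F_{A/k}^*(D^{(q)}) = q • D`** (same divisor): the relative `q`-Frobenius `F_{A/k} : A → A^{(q)}` pulls the
twisted divisor `D^{(q)} = pr^* D` back to `q • D`, because `F_{A/k} ≫ pr` is the absolute Frobenius
(`toSchemeHom_relFrobenius_comp_twistFst`) — Shimura's «`π⁻¹(X̃^f) = pX̃`». [cite: Shimura1998, proof of Thm. 18.6 p. 130 («π⁻¹(X̃^f) = pX̃»)]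
[cite: Hartshorne1977, IV §2 Rem. 2.4.1 and Ex. 2.4] -/
theorem pullback_relFrobenius_twist_sameDivisor (π : (A.frobeniusTwist p n).X.left ⟶ A.X.left)
    (hπ : π = twistFst p n A.X) [IsDominant π] [IsDominant (Hom.toSchemeHom (A.relFrobenius p n))]
    (D : CartierDivisor A.X.left) :
    ((D.pullback π).pullback (Hom.toSchemeHom (A.relFrobenius p n))).SameDivisor ((p ^ n) • D) := by
  have hcomp : Hom.toSchemeHom (A.relFrobenius p n) ≫ π = absFrobeniusOver p n A.X := by
    rw [hπ]
    exact A.toSchemeHom_relFrobenius_comp_twistFst p n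
  haveI : IsDominant (Hom.toSchemeHom (A.relFrobenius p n) ≫ π) := inferInstance
  haveI : IsDominant (absFrobeniusOver p n A.X) := A.isDominant_absFrobeniusOver p n
  exact ((D.pullback_pullback_sameDivisor _ _).trans (D.pullback_congr_sameDivisor hcomp)).trans
    (CartierDivisor.pullback_powEndo_sameDivisor A.X.left (p ^ n) _ _ (absFrobeniusOver p n A.X) rfl D)

end AbelianVariety

end Literature.AlgebraicGeometry.Motives

end
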